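import Literature.AlgebraicGeometry.Resolution.AffineChartFibres
import Literature.AlgebraicGeometry.Resolution.FormsOnAffineCharts
import Literature.AlgebraicGeometry.Resolution.FibreDimensionOne
import HarnessLib

/-!
# A hypersurface section missing the components of a fibre meets it in dimension `≤ 0`

Topic: `Literature/AlgebraicGeometry/Resolution`. For a closed subscheme `r : X ↪ ℙⁿ_k`, a
morphism `f : X → Y` all of whose fibres have all their irreducible components of dimension
`≤ 1`, a form `G` of positive degree and a closed point `y'` of `Y`: **if on affine charts
`W = (r⁻¹D₊(xᵢ))_h ⊆ f⁻¹(U)` around every point of `f⁻¹(y')` the chart value `G(s)/sᵢᵐ|_W` lies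
in no minimal prime of `𝔫A` (`𝔫` the maximal ideal of `y'` in `Γ(U)`, `A = Γ(W)`) — i.e.
`V₊(G)` contains no irreducible component of the fibre — then `X ∩ V₊(G) ∩ f⁻¹(y')` has
dimension `≤ 0`** (`topologicalKrullDim_support_inter_preimage_le_zero`). This is the reading of
"`H ∉ pr₁(T)`, `T = {(H, y) | dim f⁻¹(y) ∩ H = 1}`" in de Jong's proof of Lemma 4.13
(de Jong 1996, pp. 69–70) used to verify clause (A2) of `DeJong1996MultisectionHyperplane`.

Proof: a specialisation `z₀ ⤳ z₁`, `z₀ ≠ z₁`, inside `X ∩ V₊(G) ∩ f⁻¹(y')` forces the prime of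
`z₀` in a chart `W ∋ z₀` to be a minimal prime of `𝔫A` (a smaller one would give a chain of
length `2` in the fibre scheme `X_{y'}`, of dimension `≤ 1`), and `z₀ ∈ V₊(G)` puts the chart
value of `G` in that prime.

## References

* A. J. de Jong, *Smoothness, semi-stability and alterations*, Publ. Math. IHÉS 83 (1996),
  Lemma 4.13 (proof), pp. 69–70. [DeJong1996]
-/

noncomputable section

universe u

open CategoryTheory AlgebraicGeometry Order Topology TopologicalSpace
open Literature.AlgebraicGeometry.Motives Literature.AlgebraicGeometry.Motives.Segre
  Literature.AlgebraicGeometry.Motives.GeneratingSections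

attribute [local instance] MvPolynomial.gradedAlgebra

namespace Literature.AlgebraicGeometry.Resolution

/-! ### The hypersurface section in a fibre -/

section Main

variable {k : Type u} [Field k] {Z : SchemeOver k} {n : ℕ} (ι : Z ⟶ projectiveSpace n k)
  [IsClosedImmersion ι.left] [QuasiSeparatedSpace Z.left] {Y : Scheme.{u}} (f : Z.left ⟶ Y)

/-- **A hypersurface section containing no component of the fibre over a closed point meets that
fibre in dimension `≤ 0`.** Let `r : X ↪ ℙⁿ_k` be a closed immersion, `f : X → Y` with every
irreducible component of the fibre scheme `X_{y'}` of dimension `≤ 1`, `y'` a closed point of `Y`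
and `G` a form of degree `m`. Suppose every point `z` of `f⁻¹(y')` has an affine chart
`W = (r⁻¹D₊(xᵢ))_h ∋ z`, `W ⊆ f⁻¹(U)` for an affine open `U ∋ y'`, on which the chart value
`G(s)/sᵢᵐ` lies in no minimal prime of `𝔫Γ(W)`, `𝔫 = 𝔭_U(y')`. Then the subspace
`(X ∩ V₊(G)) ∩ f⁻¹(y')` of `X` has Krull dimension `≤ 0` (de Jong: `H ∉ pr₁(T)`).
[cite: DeJong1996, Lemma 4.13 (proof), pp. 69–70] -/
theorem topologicalKrullDim_support_inter_preimage_le_zero {m : ℕ}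
    (G : MvPolynomial (Fin (n + 1)) k) (hG : G.IsHomogeneous m) {y' : Y}
    (hy' : IsClosed ({y'} : Set Y))
    (hdim : ∀ C ∈ irreducibleComponents ↥(f.fiber y'), topologicalKrullDim ↥C ≤ (1 : ℕ))
    (H : ∀ z : Z.left, f z = y' →
      ∃ (U : Y.Opens) (hU : IsAffineOpen U) (hyU : y' ∈ U) (i : Fin (n + 1))
        (h : Γ(Z.left, preU (emb ι) i)) (hWU : Z.left.basicOpen h ≤ f ⁻¹ᵁ U),
        z ∈ Z.left.basicOpen h ∧
        ∀ P ∈ ((hU.primeIdealOf ⟨y', hyU⟩).asIdeal.map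
            (f.appLE U (Z.left.basicOpen h) hWU).hom).minimalPrimes,
          Z.left.presheaf.map (homOfLE (Z.left.basicOpen_le h)).op
            ((ofHom (emb ι)).sectionsFun Z.hom i G) ∉ P) :
    topologicalKrullDim
      ↥((((ofHom (emb ι)).secOfForm Z.hom G hG).zeroIdeal.support : Set Z.left) ∩ f ⁻¹' {y'}) ≤
        0 := by
  haveI : IsClosedImmersion (emb ι) := ‹_›
  set S : Set Z.left :=
    (((ofHom (emb ι)).secOfForm Z.hom G hG).zeroIdeal.support : Set Z.left) ∩ f ⁻¹' {y'} with hS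
  have hScl : IsClosed S :=
    (Scheme.IdealSheafData.support _).isClosed.inter (hy'.preimage f.continuous)
  -- reduce to: no proper specialisation inside `S`
  haveI : QuasiSober ↥S := Literature.Topology.quasiSober_of_isClosed hScl
  by_contra hcon
  push Not at hcon
  rw [Literature.Topology.topologicalKrullDim_eq_krullDim] at hcon
  obtain ⟨a, b, hab⟩ := (@Order.krullDim_pos_iff ↥S (specializationOrder ↥S).toPreorder).mp hcon
  -- `a < b` in the specialisation order of `S`: `b ⤳ a`, `a ≠ b`
  have hle' : (b : ↥S) ⤳ a := @le_of_lt ↥S (specializationOrder ↥S).toPreorder _ _ hab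
  have hba : (b : Z.left) ⤳ (a : Z.left) := hle'.map continuous_subtype_val
  have hne'' : a ≠ b := @ne_of_lt ↥S (specializationOrder ↥S).toPreorder _ _ hab
  have hne : (b : Z.left) ≠ a := fun h => hne'' (Subtype.ext h).symm
  -- the chart at `z₀ = b`
  obtain ⟨hbsupp, hbf⟩ := b.2
  obtain ⟨U, hU, hyU, i, h, hWU, hbW, hmin⟩ := H b hbf
  have hWaff : IsAffineOpen (Z.left.basicOpen h) := (isAffineOpen_ofHom_U (emb ι) i).basicOpen h
  have hymax := isMaximal_primeIdealOf_of_isClosed hU hyU hy'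
  set p₀ := hWaff.primeIdealOf ⟨b, hbW⟩ with hp₀
  have hb₀ : hWaff.fromSpec p₀ = b := hWaff.fromSpec_primeIdealOf ⟨b, hbW⟩
  -- (i) `𝔫A ≤ p₀`
  have hle : (hU.primeIdealOf ⟨y', hyU⟩).asIdeal.map (f.appLE U _ hWU).hom ≤ p₀.asIdeal := by
    rw [← apply_fromSpec_eq_iff_map_le f hU hWaff hWU ⟨y', hyU⟩ hymax p₀, hb₀]
    exact hbf
  -- (ii) `p₀` is minimal over `𝔫A`: a smaller prime gives a chain of length two in `X_{y'}`
  have hp₀min : p₀.asIdeal ∈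
      ((hU.primeIdealOf ⟨y', hyU⟩).asIdeal.map (f.appLE U _ hWU).hom).minimalPrimes := by
    refine ⟨⟨p₀.isPrime, hle⟩, fun q ⟨hq, hqle⟩ hqp => ?_⟩
    haveI := hq
    let q' : PrimeSpectrum Γ(Z.left, Z.left.basicOpen h) := ⟨q, hq⟩
    by_contra hne'
    have hqp' : q' < p₀ := lt_of_le_of_ne hqp fun h' => hne' (by rw [← h'])
    -- the point of `q` generises `b`, strictly, and lies over `y'`
    have hsp : hWaff.fromSpec q' ⤳ b := by
      rw [← hb₀]
      exact (Literature.AlgebraicGeometry.Dimension.Scheme.fromSpec_specializes_iff hWaff q' p₀).mpr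
        hqp
    have hfq : f (hWaff.fromSpec q') = y' :=
      (apply_fromSpec_eq_iff_map_le f hU hWaff hWU ⟨y', hyU⟩ hymax q').mpr hqle
    have hneq : hWaff.fromSpec q' ≠ b := by
      intro h'
      apply hqp'.ne
      apply hWaff.fromSpec.isOpenEmbedding.injective
      rw [h', hb₀]
    -- lift the three points to the fibre scheme
    obtain ⟨wq, hwq⟩ : hWaff.fromSpec q' ∈ Set.range (f.fiberι y') := by
      rw [Scheme.Hom.range_fiberι]; exact hfq
    obtain ⟨wb, hwb⟩ : (b : Z.left) ∈ Set.range (f.fiberι y') := by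
      rw [Scheme.Hom.range_fiberι]; exact hbf
    obtain ⟨wa, hwa⟩ : (a : Z.left) ∈ Set.range (f.fiberι y') := by
      rw [Scheme.Hom.range_fiberι]; exact a.2.2
    have hind := (f.fiberι y').isEmbedding.isInducing
    have h1 : wq ⤳ wb := by rw [← hind.specializes_iff, hwq, hwb]; exact hsp
    have h2 : wb ⤳ wa := by rw [← hind.specializes_iff, hwb, hwa]; exact hba
    have h1' : wq ≠ wb := fun h' => hneq (by rw [← hwq, ← hwb, h'])
    have h2' : wb ≠ wa := fun h' => hne (by rw [← hwb, ← hwa, h'])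
    exact not_specializes_specializes_of_dim_le_one hdim h1 h2 h1' h2'
  -- (iii) the chart value of `G` lies in `p₀`
  have hval : Z.left.presheaf.map (homOfLE (Z.left.basicOpen_le h)).op
      ((ofHom (emb ι)).sectionsFun Z.hom i G) ∈ p₀.asIdeal := by
    have hbU : (b : Z.left) ∈ (ofHom (emb ι)).U i := Z.left.basicOpen_le h hbW
    have h1 := (((ofHom (emb ι)).secOfForm Z.hom G hG).mem_support_zeroIdeal_iff
      (isAffineOpen_ofHom_U (emb ι)) hbU).mp hbsupp
    rw [secOfForm_val] at h1
    by_contra hnot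
    have h2 : (b : Z.left) ∈ Z.left.basicOpen (Z.left.presheaf.map
        (homOfLE (Z.left.basicOpen_le h)).op ((ofHom (emb ι)).sectionsFun Z.hom i G)) :=
      (FieldNorm.mem_basicOpen_iff_notMem_primeIdealOf hWaff _ hbW).mpr hnot
    rw [Scheme.basicOpen_res] at h2
    exact h1 h2.2
  exact hmin _ hp₀min hval

end Main

end Literature.AlgebraicGeometry.Resolution
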